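import Summits.AtomisticToContinuum.BoseEinsteinCondensation.Theorems.BECGroundStateSOSPeriodicIRBoundTwoSectorFloatingReduction
import HarnessLib

/-!
# Route `BECGroundStateSOS`, crux `PeriodicIRBound` (stmt-AtomisticToContinuum-3972) — GLUE of the typed split
# `PeriodicIRBound ⟸ FloatingTwoChannelKLS ∧ NonIntegrablePeriodicIRBound` (strategist s2, 2026-08-17)

The two children are written over LITERATURE vocabulary only (as route items must be): `FloatingTwoChannelKLS` is lead
c22's S1' `TwoSectorGdTransfer.FloatingTwoChannel` with `FloatingFor`, `ChanPlus`, `ChanMinus`, `NearMinAt`, `WF.qform`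
unfolded (`let`-bound abbreviations `L`, `nk`, `qC`, `qA`); `NonIntegrablePeriodicIRBound` is S6 `NonIntegrableHalf` with
`IRBoundFor`, `NearMin`, `InWindow`, `IRIneq` unfolded. Both unfoldings are DEFINITIONAL: the proof below is the landed
reduction `TwoSectorGdTransfer.stub_periodicIRBoundOfFloating` (p155164) applied verbatim, so the kernel checks the
`δ`/`ζ`-equality of the children with S1'/S6. The same two statement texts are the `--into` children of the route split;
the gate's glue item `FloatingTwoChannelKLS → NonIntegrablePeriodicIRBound → PeriodicIRBound` is closed by
`PeriodicIRBound_of_subs` (one `exact`).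
-/

namespace Summit.AtomisticToContinuum.BoseEinsteinCondensation.Theorems.BECGroundStateSOSPeriodicIRBoundSplit

open Summit.AtomisticToContinuum.BoseEinsteinCondensation.Theses.BECGroundStateSOS (PeriodicIRBound)
open Summit.AtomisticToContinuum.BoseEinsteinCondensation.Cruxes.PeriodicIRBound.TwoSectorGdTransfer
  (FloatingTwoChannel NonIntegrableHalf stub_periodicIRBoundOfFloating)

/-- Child 1 (S1', unfolded over Literature vocabulary) ↔ `FloatingTwoChannel`: definitional. [folklore] -/
theorem floatingTwoChannelKLS_iff :
    (∀ v : ℝ → ENNReal, Literature.MathematicalPhysics.QuantumManyBody.BoseGas.IsRepulsiveFiniteRange v → (∫⁻ x : EuclideanSpace ℝ (Fin 3), v ‖x‖) ≠ ⊤ → ∃ K : ℝ, 0 < K ∧ ∃ ρ₀ : ℝ, 0 < ρ₀ ∧ ∃ C : ℝ, 0 < C ∧ ∀ ε : ℝ, 0 < ε → ∀ ρ : ℝ, 0 < ρ → ρ < ρ₀ → ∀ᶠ m : ℕ in Filter.atTop, let L : ℝ := Literature.MathematicalPhysics.QuantumManyBody.BoseGas.sideLength ρ (m + 2); ∀ n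 : Fin 3 → ℤ, n ≠ 0 → 2 * Real.pi / L * ‖(fun j => (n j : ℝ))‖ ≤ K → ∃ μp μm : ℝ, 0 ≤ μp ∧ μm ≤ μp + ε * Real.sqrt (ρ * (Literature.MathematicalPhysics.QuantumManyBody.BoseGas.scatteringLength v).toReal) / L ∧ (∀ η : ℝ, 0 < η → ∃ δ : ENNReal, 0 < δ ∧ ∀ Ψ : Literature.MathematicalPhysics.QuantumManyBody.BoseGas.PeriodicTrialState (m + 2) L, Literature.MathematicalPhysics.QuantumManyBody.BoseGas.periodicEnergy v Ψ ≤ Literature.MathematicalPhysics.QuantumManyBody.BoseGas.periodicGroundStateEnergy v (m + 2) L + δ → let nk : ℝ := (Literature.MathematicalPhysics.QuantumManyBody.BoseGas.cellOccupation (m + 2) L (Literature.MathematicalPhysics.QuantumManyBody.BoseGas.planeWaveMode L n) Ψ.ψ).toReal; let qC : ℝ := (∫⁻ X in Literature.MathematicalPhysics.QuantumManyBody.BoseGas.cellN (m + 2 + 1) L, (Literature.MathematicalPhysics.QuantumManyBody.BoseGas.kineticDensity (Literature.MathematicalPhysics.QuantumManyBody.BoseGas.modeCr (Literature.MathematicalPhysics.QuantumManyBody.BoseGas.planeWaveMode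 L n) Ψ.ψ) X + Literature.MathematicalPhysics.QuantumManyBody.BoseGas.periodicInteraction v L X * ((‖(Literature.MathematicalPhysics.QuantumManyBody.BoseGas.modeCr (Literature.MathematicalPhysics.QuantumManyBody.BoseGas.planeWaveMode L n) Ψ.ψ) X‖₊ : ENNReal)) ^ 2)).toReal; (nk + 1) ^ 2 ≤ (C * L ^ 2 / ‖(fun j => (n j : ℝ))‖ ^ 2) * ((1 + η) * (qC - ((Literature.MathematicalPhysics.QuantumManyBody.BoseGas.periodicGroundStateEnergy v (m + 2) L).toReal + μp) * (nk + 1)) + η * (nk + 1))) ∧ (∀ η : ℝ, 0 < η → ∃ δ : ENNReal, 0 < δ ∧ ∀ Ψ : Literature.MathematicalPhysics.QuantumManyBody.BoseGas.PeriodicTrialState (m + 2) L, Literature.MathematicalPhysics.QuantumManyBody.BoseGas.periodicEnergy v Ψ ≤ Literature.MathematicalPhysics.QuantumManyBody.BoseGas.periodicGroundStateEnergy v (m + 2) L + δ → let nk : ℝ := (Literature.MathematicalPhysics.QuantumManyBody.BoseGas.cellOccupation (m + 2) L (Literature.MathematicalPhysics.QuantumManyBody.BoseGas.planeWaveMode L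 n) Ψ.ψ).toReal; let qA : ℝ := (∫⁻ X in Literature.MathematicalPhysics.QuantumManyBody.BoseGas.cellN (m + 1) L, (Literature.MathematicalPhysics.QuantumManyBody.BoseGas.kineticDensity (Literature.MathematicalPhysics.QuantumManyBody.BoseGas.modeAn L (Literature.MathematicalPhysics.QuantumManyBody.BoseGas.planeWaveMode L n) Ψ.ψ) X + Literature.MathematicalPhysics.QuantumManyBody.BoseGas.periodicInteraction v L X * ((‖(Literature.MathematicalPhysics.QuantumManyBody.BoseGas.modeAn L (Literature.MathematicalPhysics.QuantumManyBody.BoseGas.planeWaveMode L n) Ψ.ψ) X‖₊ : ENNReal)) ^ 2)).toReal; nk ^ 2 ≤ (C * L ^ 2 / ‖(fun j => (n j : ℝ))‖ ^ 2) * ((1 + η) * (qA - ((Literature.MathematicalPhysics.QuantumManyBody.BoseGas.periodicGroundStateEnergy v (m + 2) L).toReal - μm) * nk) + η * nk))) ↔ FloatingTwoChannel :=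
  Iff.rfl

/-- Child 2 (S6, unfolded) ↔ `NonIntegrableHalf`: definitional. [folklore] -/
theorem nonIntegrablePeriodicIRBound_iff :
    (∀ v : ℝ → ENNReal, Literature.MathematicalPhysics.QuantumManyBody.BoseGas.IsRepulsiveFiniteRange v → (∫⁻ x : EuclideanSpace ℝ (Fin 3), v ‖x‖) = ⊤ → ∀ κ : ℝ, 0 < κ → ∃ ρ₀ : ℝ, 0 < ρ₀ ∧ ∃ C : ℝ, 0 < C ∧ ∀ ρ : ℝ, 0 < ρ → ρ < ρ₀ → ∀ᶠ N : ℕ in Filter.atTop, let L : ℝ := Literature.MathematicalPhysics.QuantumManyBody.BoseGas.sideLength ρ N; ∃ δ : ENNReal, 0 < δ ∧ ∀ Ψ : Literature.MathematicalPhysics.QuantumManyBody.BoseGas.PeriodicTrialState N L, Literature.MathematicalPhysics.QuantumManyBody.BoseGas.periodicEnergy v Ψ ≤ Literature.MathematicalPhysics.QuantumManyBody.BoseGas.periodicGroundStateEnergy v N L + δ → ∀ k : Fin 3 → ℤ, (k ≠ 0 ∧ ‖(fun j => (k j : ℝ))‖ ≤ κ * Real.sqrt ρ * L) → Literature.MathematicalPhysics.QuantumManyBody.BoseGas.cellOccupation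 N L (fun x => ((Real.sqrt (L ^ 3))⁻¹ : ℂ) * Literature.MathematicalPhysics.QuantumManyBody.BoseGas.cellWave L k x) Ψ.ψ ≤ ENNReal.ofReal (C * Real.sqrt ρ * L / ‖(fun j => (k j : ℝ))‖)) ↔ NonIntegrableHalf :=
  Iff.rfl

/-- **GLUE of the split `PeriodicIRBound ⟸ S1' ∧ S6`** (children unfolded over Literature vocabulary): the landed
fourth standing reduction `stub_periodicIRBoundOfFloating` (p155164 = S4' p152976 + S5' p153397 + the scope split
`Negative.periodicIRBound_iff_split`), verbatim up to `δ`/`ζ`-unfolding. [folklore] -/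
theorem PeriodicIRBound_of_subs :
    (∀ v : ℝ → ENNReal, Literature.MathematicalPhysics.QuantumManyBody.BoseGas.IsRepulsiveFiniteRange v → (∫⁻ x : EuclideanSpace ℝ (Fin 3), v ‖x‖) ≠ ⊤ → ∃ K : ℝ, 0 < K ∧ ∃ ρ₀ : ℝ, 0 < ρ₀ ∧ ∃ C : ℝ, 0 < C ∧ ∀ ε : ℝ, 0 < ε → ∀ ρ : ℝ, 0 < ρ → ρ < ρ₀ → ∀ᶠ m : ℕ in Filter.atTop, let L : ℝ := Literature.MathematicalPhysics.QuantumManyBody.BoseGas.sideLength ρ (m + 2); ∀ n : Fin 3 → ℤ, n ≠ 0 → 2 * Real.pi / L * ‖(fun j => (n j : ℝ))‖ ≤ K → ∃ μp μm : ℝ, 0 ≤ μp ∧ μm ≤ μp + ε * Real.sqrt (ρ * (Literature.MathematicalPhysics.QuantumManyBody.BoseGas.scatteringLength v).toReal) / L ∧ (∀ η : ℝ, 0 < η → ∃ δ : ENNReal, 0 < δ ∧ ∀ Ψ : Literature.MathematicalPhysics.QuantumManyBody.BoseGas.PeriodicTrialState (m + 2) L, Literature.MathematicalPhysics.QuantumManyBody.BoseGas.periodicEnergy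 v Ψ ≤ Literature.MathematicalPhysics.QuantumManyBody.BoseGas.periodicGroundStateEnergy v (m + 2) L + δ → let nk : ℝ := (Literature.MathematicalPhysics.QuantumManyBody.BoseGas.cellOccupation (m + 2) L (Literature.MathematicalPhysics.QuantumManyBody.BoseGas.planeWaveMode L n) Ψ.ψ).toReal; let qC : ℝ := (∫⁻ X in Literature.MathematicalPhysics.QuantumManyBody.BoseGas.cellN (m + 2 + 1) L, (Literature.MathematicalPhysics.QuantumManyBody.BoseGas.kineticDensity (Literature.MathematicalPhysics.QuantumManyBody.BoseGas.modeCr (Literature.MathematicalPhysics.QuantumManyBody.BoseGas.planeWaveMode L n) Ψ.ψ) X + Literature.MathematicalPhysics.QuantumManyBody.BoseGas.periodicInteraction v L X * ((‖(Literature.MathematicalPhysics.QuantumManyBody.BoseGas.modeCr (Literature.MathematicalPhysics.QuantumManyBody.BoseGas.planeWaveMode L n) Ψ.ψ) X‖₊ : ENNReal)) ^ 2)).toReal; (nk + 1) ^ 2 ≤ (C * L ^ 2 / ‖(fun j => (n j : ℝ))‖ ^ 2) * ((1 + η) * (qC - ((Literature.MathematicalPhysics.QuantumManyBody.BoseGas.periodicGroundStateEnergy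 v (m + 2) L).toReal + μp) * (nk + 1)) + η * (nk + 1))) ∧ (∀ η : ℝ, 0 < η → ∃ δ : ENNReal, 0 < δ ∧ ∀ Ψ : Literature.MathematicalPhysics.QuantumManyBody.BoseGas.PeriodicTrialState (m + 2) L, Literature.MathematicalPhysics.QuantumManyBody.BoseGas.periodicEnergy v Ψ ≤ Literature.MathematicalPhysics.QuantumManyBody.BoseGas.periodicGroundStateEnergy v (m + 2) L + δ → let nk : ℝ := (Literature.MathematicalPhysics.QuantumManyBody.BoseGas.cellOccupation (m + 2) L (Literature.MathematicalPhysics.QuantumManyBody.BoseGas.planeWaveMode L n) Ψ.ψ).toReal; let qA : ℝ := (∫⁻ X in Literature.MathematicalPhysics.QuantumManyBody.BoseGas.cellN (m + 1) L, (Literature.MathematicalPhysics.QuantumManyBody.BoseGas.kineticDensity (Literature.MathematicalPhysics.QuantumManyBody.BoseGas.modeAn L (Literature.MathematicalPhysics.QuantumManyBody.BoseGas.planeWaveMode L n) Ψ.ψ) X + Literature.MathematicalPhysics.QuantumManyBody.BoseGas.periodicInteraction v L X * ((‖(Literature.MathematicalPhysics.QuantumManyBody.BoseGas.modeAn L (Literature.MathematicalPhysics.QuantumManyBody.BoseGas.planeWaveMode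 L n) Ψ.ψ) X‖₊ : ENNReal)) ^ 2)).toReal; nk ^ 2 ≤ (C * L ^ 2 / ‖(fun j => (n j : ℝ))‖ ^ 2) * ((1 + η) * (qA - ((Literature.MathematicalPhysics.QuantumManyBody.BoseGas.periodicGroundStateEnergy v (m + 2) L).toReal - μm) * nk) + η * nk))) →
    (∀ v : ℝ → ENNReal, Literature.MathematicalPhysics.QuantumManyBody.BoseGas.IsRepulsiveFiniteRange v → (∫⁻ x : EuclideanSpace ℝ (Fin 3), v ‖x‖) = ⊤ → ∀ κ : ℝ, 0 < κ → ∃ ρ₀ : ℝ, 0 < ρ₀ ∧ ∃ C : ℝ, 0 < C ∧ ∀ ρ : ℝ, 0 < ρ → ρ < ρ₀ → ∀ᶠ N : ℕ in Filter.atTop, let L : ℝ := Literature.MathematicalPhysics.QuantumManyBody.BoseGas.sideLength ρ N; ∃ δ : ENNReal, 0 < δ ∧ ∀ Ψ : Literature.MathematicalPhysics.QuantumManyBody.BoseGas.PeriodicTrialState N L, Literature.MathematicalPhysics.QuantumManyBody.BoseGas.periodicEnergy v Ψ ≤ Literature.MathematicalPhysics.QuantumManyBody.BoseGas.periodicGroundStateEnergy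 v N L + δ → ∀ k : Fin 3 → ℤ, (k ≠ 0 ∧ ‖(fun j => (k j : ℝ))‖ ≤ κ * Real.sqrt ρ * L) → Literature.MathematicalPhysics.QuantumManyBody.BoseGas.cellOccupation N L (fun x => ((Real.sqrt (L ^ 3))⁻¹ : ℂ) * Literature.MathematicalPhysics.QuantumManyBody.BoseGas.cellWave L k x) Ψ.ψ ≤ ENNReal.ofReal (C * Real.sqrt ρ * L / ‖(fun j => (k j : ℝ))‖)) →
    PeriodicIRBound :=
  fun h1 h6 => stub_periodicIRBoundOfFloating h1 h6

end Summit.AtomisticToContinuum.BoseEinsteinCondensation.Theorems.BECGroundStateSOSPeriodicIRBoundSplit
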